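import Summits.ResolutionOfSingularities.ResolutionOfSingularities.Theorems.FrobeniusLadderFInjectiveMacaulayficationToricChartFedderAssembly
import Summits.ResolutionOfSingularities.ResolutionOfSingularities.Theorems.FrobeniusLadderFInjectiveMacaulayficationFrobeniusPowerOfFedderAt
import Summits.ResolutionOfSingularities.ResolutionOfSingularities.Theorems.FrobeniusLadderFInjectiveMacaulayficationFedderAtMaximalIdeal
import Mathlib.RingTheory.Finiteness.Defs
import Mathlib.RingTheory.Polynomial.Basic
import HarnessLib

/-!
# (G4ᴾ) THE CN CHART CLAUSE OVER THE ORIGIN = C2 + C3a + Fedder at a maximal ideal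
# (crux `FInjectiveMacaulayfication`, CN engine in global form — `L/w45a/CNEngineSig.lean` c51053d0 / skeleton v15 `stub_cnChartClause`,
# statement VERBATIM)

Support file for crux stmt-ResolutionOfSingularities-15315 (`FrobeniusLadder.FInjectiveMacaulayfication`), chain w45a,
seat res-L1-w45a-stub-3 (idle-seat pickup of stub-4's piece, announced on STATUS). [OURS · L1 W4.5a] — NOT a statement of the
manuscript; AI-written, weaker than expert review.

One vertex chart `θ : Xⱼ ↦ ∏ᵢ yᵢ^(V i j)` (`V` unimodular) of the monomial blow-up, `θ f = y^d · g`, `(g)` prime, `g ≠ 0`; Cartier–Newton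
nondegeneracy in Fedder form for every strictly positive row-subset weight `w_S = Σ_(i ∈ S) vᵢ`; a simultaneous minimiser of all rows on
`supp f`. CLAIM: `k[y]/(g)` satisfies the Cohen–Macaulay + Frobenius-closed clause at every maximal `Q` containing all `θ(Xⱼ)`.

Proof (`cnChartClause`): `P := Q ∩ k[y]` (maximal), `K := k[y]/P`, tautological point `a = (ȳᵢ)`, `S := {i : aᵢ = 0}`. Since every
`θ(Xⱼ) = ∏ aᵢ^(V i j)` vanishes in `K`, each column of `V` meets `S` (`w_S` strictly positive) and `S ≠ ∅` (`n > 0`). C2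
`ToricChartFedderAssembly.toricChart_fedder` (p490448) gives Fedder's test for `g ⊗ K` at `a`; (C3a) `FrobeniusPowerOfFedderAt` (p492570)
turns it into `g^(p-1) ∉ P^[p]`, a fortiori `g^(p-1) ∉ (aᵢ^p)` for any finite generating family `(aᵢ)` of `P`; and
`FedderAtMaximalIdeal.stub_fedderAtMaximalIdeal` (Fedder in the regular local ring `k[y]_P`, transported to `(k[y]/(g))_Q`) is the clause.

No definitions, no named facts; glue. [folklore]
-/

-- single-problem summit: the doubled namespace component is forced
set_option linter.dupNamespace false

noncomputable section

namespace Summit.ResolutionOfSingularities.ResolutionOfSingularities.Theorems.FInjectiveMacaulayfication.CNChartClause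

open Summit.ResolutionOfSingularities.ResolutionOfSingularities.Theorems.FInjectiveMacaulayfication
open Literature.RingTheory.TightClosure

/-- **(G4ᴾ) THE CN CHART CLAUSE OVER THE ORIGIN** (`stub_cnChartClause`, verbatim). One vertex chart: `V` unimodular, `θ f = y^d · g`,
`g ≠ 0` with `(g)` prime, the faces of the cone cut by the STRICTLY POSITIVE row-subset weights `w_S = Σ_(i ∈ S) vᵢ` all F-pure on the
torus (Cartier–Newton nondegeneracy, Fedder form), and a simultaneous minimiser of all rows on `supp f`. Then `k[y]/(g)` satisfies the
Cohen–Macaulay + Frobenius-closed clause at every maximal ideal containing all `θ(X_j)`. [folklore] -/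
theorem cnChartClause : ∀ (p : ℕ) [Fact p.Prime] (k : Type) [Field k] [CharP k p] (n : ℕ), 0 < n →
    ∀ (f : MvPolynomial (Fin n) k) (V : Matrix (Fin n) (Fin n) ℕ), IsUnit (V.map (Nat.cast : ℕ → ℤ)).det →
    ∀ (d : Fin n →₀ ℕ) (g : MvPolynomial (Fin n) k), (Ideal.span {g}).IsPrime →
    MvPolynomial.aeval (fun j : Fin n => ∏ i : Fin n, (MvPolynomial.X i : MvPolynomial (Fin n) k) ^ V i j) f = MvPolynomial.monomial d 1 * g → g ≠ 0 →
    (∀ S : Finset (Fin n), (∀ j : Fin n, 0 < ∑ i ∈ S, V i j) →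
      (∀ D : ℕ, (MvPolynomial.weightedHomogeneousComponent (fun j : Fin n => ∑ i ∈ S, V i j) D f ≠ 0 ∧
          ∀ D' < D, MvPolynomial.weightedHomogeneousComponent (fun j : Fin n => ∑ i ∈ S, V i j) D' f = 0) →
        ∀ (K : Type) [Field K] [Algebra k K] (b : Fin n → K), (∀ i, b i ≠ 0) →
          MvPolynomial.aeval b (MvPolynomial.weightedHomogeneousComponent (fun j : Fin n => ∑ i ∈ S, V i j) D f) = 0 →
          (MvPolynomial.map (algebraMap k K) (MvPolynomial.weightedHomogeneousComponent (fun j : Fin n => ∑ i ∈ S, V i j) D f)) ^ (p - 1) ∉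
            Ideal.span (Set.range fun i : Fin n => (MvPolynomial.X i - MvPolynomial.C (b i)) ^ p))) →
    (∃ m ∈ f.support, ∀ i : Fin n, ∑ j : Fin n, V i j * m j = d i) →
    ∀ (Q : Ideal (MvPolynomial (Fin n) k ⧸ Ideal.span {g})) [Q.IsMaximal],
    (∀ j : Fin n, Ideal.Quotient.mk (Ideal.span {g}) (∏ i : Fin n, MvPolynomial.X i ^ V i j) ∈ Q) →
    ∀ d : ℕ, ringKrullDim (Localization.AtPrime Q) = d → ∀ s : Fin d → Localization.AtPrime Q,
        (Ideal.span (Set.range s)).radical.IsMaximal →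
          RingTheory.Sequence.IsWeaklyRegular (Localization.AtPrime Q) (List.ofFn s) ∧
          ∀ y : Localization.AtPrime Q, (∃ e : ℕ, y ^ p ^ e ∈ Ideal.span
            ((fun z : Localization.AtPrime Q => z ^ p ^ e) ''
              (Ideal.span (Set.range s) : Set (Localization.AtPrime Q)))) → y ∈ Ideal.span (Set.range s) := by
  intro p _ k _ _ n hn f V hV dv g hgp hθ hg0 hCN hface Q _ hXQ
  classical
  -- the contraction `P` of `Q` to `k[y]`, its residue field `K` and the tautological point `a`
  set P : Ideal (MvPolynomial (Fin n) k) := Q.comap (Ideal.Quotient.mk (Ideal.span {g})) with hP_def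
  haveI hPmax : P.IsMaximal := Ideal.comap_isMaximal_of_surjective _ Ideal.Quotient.mk_surjective
  letI : Field (MvPolynomial (Fin n) k ⧸ P) := Ideal.Quotient.field P
  haveI : CharP (MvPolynomial (Fin n) k ⧸ P) p :=
    charP_of_injective_algebraMap (algebraMap k (MvPolynomial (Fin n) k ⧸ P)).injective p
  have hgP : g ∈ P := by
    rw [hP_def, Ideal.mem_comap, Ideal.Quotient.eq_zero_iff_mem.mpr (Ideal.mem_span_singleton_self g)]
    exact Q.zero_mem
  -- `aeval a = mk_P` on `k[y]`
  have haev : ∀ q : MvPolynomial (Fin n) k,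
      MvPolynomial.aeval (fun i : Fin n => Ideal.Quotient.mk P (MvPolynomial.X i)) q = Ideal.Quotient.mk P q := by
    intro q
    have h : (MvPolynomial.aeval (R := k) (fun i : Fin n => Ideal.Quotient.mk P (MvPolynomial.X i))) =
        Ideal.Quotient.mkₐ k P := MvPolynomial.algHom_ext fun i => by
      rw [MvPolynomial.aeval_X, Ideal.Quotient.mkₐ_eq_mk]
    rw [h, Ideal.Quotient.mkₐ_eq_mk]
  have ha : MvPolynomial.aeval (fun i : Fin n => Ideal.Quotient.mk P (MvPolynomial.X i)) g = 0 := by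
    rw [haev, Ideal.Quotient.eq_zero_iff_mem]
    exact hgP
  -- the vanishing set `S` of the coordinates: every column of `V` meets it, and it is non-empty
  set S : Finset (Fin n) := Finset.univ.filter fun i => Ideal.Quotient.mk P (MvPolynomial.X i) = 0 with hS_def
  have hS : ∀ i, i ∈ S ↔ Ideal.Quotient.mk P (MvPolynomial.X i) = 0 := fun i => by
    rw [hS_def, Finset.mem_filter]
    exact ⟨fun h => h.2, fun h => ⟨Finset.mem_univ i, h⟩⟩
  have hcol : ∀ j : Fin n, ∃ i ∈ S, 0 < V i j := by
    intro j
    have h1 : Ideal.Quotient.mk P (∏ i : Fin n, MvPolynomial.X i ^ V i j) = 0 := by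
      rw [Ideal.Quotient.eq_zero_iff_mem, hP_def, Ideal.mem_comap]
      exact hXQ j
    rw [map_prod, Finset.prod_eq_zero_iff] at h1
    obtain ⟨i, -, hi⟩ := h1
    rw [map_pow] at hi
    have hV0 : V i j ≠ 0 := by
      intro h0
      rw [h0, pow_zero] at hi
      exact one_ne_zero hi
    exact ⟨i, (hS i).mpr (pow_eq_zero_iff hV0 |>.mp hi), Nat.pos_of_ne_zero hV0⟩
  have hSpos : ∀ j : Fin n, 0 < ∑ i ∈ S, V i j := by
    intro j
    obtain ⟨i, hi, hVij⟩ := hcol j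
    exact lt_of_lt_of_le hVij (Finset.single_le_sum (fun i _ => Nat.zero_le (V i j)) hi)
  have hSne : S.Nonempty := by
    obtain ⟨i, hi, -⟩ := hcol ⟨0, hn⟩
    exact ⟨i, hi⟩
  -- C2: Fedder's test for `g ⊗ K` at `a`
  have hfedK := ToricChartFedderAssembly.toricChart_fedder p f V hV dv g hθ (MvPolynomial (Fin n) k ⧸ P)
    (fun i : Fin n => Ideal.Quotient.mk P (MvPolynomial.X i)) S hS hSne (hCN S hSpos)
    (by obtain ⟨m, hm, hmin⟩ := hface; exact ⟨m, hm, fun i _ => hmin i⟩) ha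
  -- C3a: `g^(p-1) ∉ P^[p]`
  have hfrob := FrobeniusPowerOfFedderAt.frobeniusPower_of_fedderAt p k n g P hfedK
  -- generators of `P` and Fedder at the maximal ideal
  obtain ⟨m, gens, hgens⟩ := Submodule.fg_iff_exists_fin_generating_family.mp ((isNoetherianRing_iff_ideal_fg _).mp inferInstance P)
  have hfed : g ^ (p - 1) ∉ Ideal.span (Set.range fun i : Fin m => gens i ^ p) := by
    intro h
    apply hfrob
    refine (Ideal.span_le.mpr ?_) h
    rintro _ ⟨i, rfl⟩
    exact pow_mem_frobeniusPower (by rw [← hgens]; exact Submodule.subset_span ⟨i, rfl⟩)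
  exact FedderAtMaximalIdeal.stub_fedderAtMaximalIdeal p k n m gens g Q hgens.symm hg0 hfed

end Summit.ResolutionOfSingularities.ResolutionOfSingularities.Theorems.FInjectiveMacaulayfication.CNChartClause

end
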